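import Mathlib
import Literature.Analysis.FluidPDE.CheskidovFriedlander2009.EnergyInequality
import Literature.Analysis.FluidPDE.CheskidovFriedlander2009.InviscidBlowup
import HarnessLib

/-!
# Cheskidov–Friedlander–Pavlović 2010, Theorem 4.5 PROVED: the energy equality for
# `H^{5/6}`-regular solutions of the forced inviscid dyadic model (Onsager's rigid side)

A. Cheskidov, S. Friedlander, N. Pavlović, *An inviscid dyadic model of turbulence: the global
attractor*, Discrete Contin. Dyn. Syst. 26 (2010) 781–794 = arXiv:math/0610815v1, **Thm. 4.5**
p. 11 (locators: arXiv v1 PDF).  Discharge of the named fact `CheskidovFriedlanderPavlovic2010_thm45`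
(`InviscidBlowup.lean`): if `‖a(t)‖³_{5/6}` is integrable on `[T₁,T₂]` then
`|a(t)|² = |a(t₀)|² + 2∫_{t₀}^t(f,a(τ))dτ` (4.35) for `T₁ ≤ t₀ ≤ t ≤ T₂`.

The printed proof, followed here: the truncated energy balance (3.10) (tree:
`IsSolution.truncEnergy_eq`, `EnergyInequality.lean`, at `ν = 0`) reads
`Σ_{j≤N}a_j(t)² − Σ_{j≤N}a_j(t₀)² = −2∫_{t₀}^t λ^N a_N²a_{N+1} + 2∫_{t₀}^t f₀a₀`; by `ℓ^{3/2} ⊂ ℓ¹`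
applied to `h_j = λ^{2j/3}a_j²` (4.36), `∫Σ_jλ^j|a_j|³ ≤ ∫(Σ_jλ^{2j/3}a_j²)^{3/2} = ∫‖a‖³_{5/6} < ∞`
(`ENNReal.tsum_rpow_le_rpow_tsum`, `lintegral_tsum`), so (4.37) `∫λ^N|a_N|³ → 0`, and (4.38)
`|λ^Na_N²a_{N+1}| ≤ λ^N|a_N|³ + λ^{N+1}|a_{N+1}|³` (Young) lets `N → ∞` in (3.10), giving (4.39).
(The paper writes (4.38) without absolute values; the theorem carries no sign hypothesis and the
absolute-value form is what the argument uses.)  No new definitions, no new facts.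

## References
* [CheskidovFriedlanderPavlovic2010] A. Cheskidov, S. Friedlander, N. Pavlović, An inviscid
  dyadic model of turbulence: the global attractor, DCDS 26 (2010) 781–794, Thm. 4.5,
  (4.35)–(4.39) p. 11; Thm. 3.3 (3.10) p. 5.
-/

noncomputable section

open Set Filter MeasureTheory Finset
open scoped Topology ENNReal

namespace Literature.Analysis.FluidPDE.CheskidovFriedlander2009

/-! ### `ℓ^{p} ⊂ ℓ¹` for `p ≥ 1` (the inequality behind (4.36)) -/

/-- `Σ_{i∈s} x_i^p ≤ (Σ_{i∈s} x_i)^p` in `[0,∞]` for `p ≥ 1` ("if `p ≥ q` then `‖h‖_{ℓ^p} ≤ ‖h‖_{ℓ^q}`",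
here `q = 1`). [cite: CheskidovFriedlanderPavlovic2010, Thm 4.5 (4.36) p.11] -/
theorem ENNReal.sum_rpow_le_rpow_sum {ι : Type*} (s : Finset ι) (x : ι → ℝ≥0∞) {p : ℝ}
    (hp : 1 ≤ p) : ∑ i ∈ s, x i ^ p ≤ (∑ i ∈ s, x i) ^ p := by
  classical
  induction s using Finset.induction_on with
  | empty => simp [ENNReal.zero_rpow_of_pos (by linarith : (0 : ℝ) < p)]
  | insert a s ha ih =>
    rw [sum_insert ha, sum_insert ha]
    exact (add_le_add le_rfl ih).trans (ENNReal.add_rpow_le_rpow_add _ _ hp)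

/-- `Σ_j x_j^p ≤ (Σ_j x_j)^p` in `[0,∞]` for `p ≥ 1` (countable version).
[cite: CheskidovFriedlanderPavlovic2010, Thm 4.5 (4.36) p.11] -/
theorem ENNReal.tsum_rpow_le_rpow_tsum (x : ℕ → ℝ≥0∞) {p : ℝ} (hp : 1 ≤ p) :
    ∑' j, x j ^ p ≤ (∑' j, x j) ^ p := by
  rw [ENNReal.tsum_eq_iSup_nat]
  refine iSup_le fun N => (ENNReal.sum_rpow_le_rpow_sum _ x hp).trans ?_
  exact ENNReal.rpow_le_rpow (ENNReal.sum_le_tsum _) (by linarith)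

/-! ### The cubic weights: `(λ^{2j/3}a_j²)^{3/2} = λ^j|a_j|³` and Young's inequality (4.38) -/

/-- `(2^{2·(5/6)·j}x²)^{3/2} = (2^{5/2})^j|x|³` — the summand of `‖a‖²_{5/6}` raised to the power
`3/2` is `λ^j|a_j|³`. [cite: CheskidovFriedlanderPavlovic2010, Thm 4.5 (4.36) p.11] -/
theorem weight_rpow_three_halves (j : ℕ) (x : ℝ) :
    ((2 : ℝ) ^ (2 * (5 / 6) * (j : ℝ)) * x ^ 2) ^ (3 / 2 : ℝ) =
      ((2 : ℝ) ^ (5 / 2 : ℝ)) ^ j * |x| ^ 3 := by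
  have h2 : (0 : ℝ) ≤ (2 : ℝ) ^ (2 * (5 / 6) * (j : ℝ)) := (Real.rpow_pos_of_pos two_pos _).le
  rw [Real.mul_rpow h2 (sq_nonneg x), ← Real.rpow_mul (by norm_num : (0 : ℝ) ≤ 2),
    show 2 * (5 / 6) * (j : ℝ) * (3 / 2) = (5 / 2 : ℝ) * (j : ℝ) by ring,
    Real.rpow_mul (by norm_num : (0 : ℝ) ≤ 2), Real.rpow_natCast, ← sq_abs x,
    ← Real.rpow_natCast |x| 2, ← Real.rpow_mul (abs_nonneg x)]
  norm_num

/-- **(4.38), pointwise**: `|λ^Nx²y| ≤ λ^N|x|³ + λ^{N+1}|y|³` for `λ ≥ 1` (Young: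
`x²|y| ≤ (2|x|³ + |y|³)/3`). [cite: CheskidovFriedlanderPavlovic2010, Thm 4.5 (4.38) p.11] -/
theorem abs_flux_le {L : ℝ} (hL : 1 ≤ L) (N : ℕ) (x y : ℝ) :
    |L ^ N * x ^ 2 * y| ≤ L ^ N * |x| ^ 3 + L ^ (N + 1) * |y| ^ 3 := by
  have hLN : 0 ≤ L ^ N := pow_nonneg (by linarith) N
  have hu : 0 ≤ |x| := abs_nonneg x
  have hv : 0 ≤ |y| := abs_nonneg y
  have hyoung : x ^ 2 * |y| ≤ |x| ^ 3 + |y| ^ 3 := by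
    rw [← sq_abs x]
    nlinarith [mul_nonneg (sq_nonneg (|x| - |y|)) (by positivity : 0 ≤ 2 * |x| + |y|),
      pow_nonneg hu 3, pow_nonneg hv 3]
  rw [abs_mul, abs_mul, abs_of_nonneg hLN, abs_of_nonneg (sq_nonneg x)]
  have h1 : L ^ N * |y| ^ 3 ≤ L ^ (N + 1) * |y| ^ 3 := by
    rw [pow_succ]
    exact mul_le_mul_of_nonneg_right (le_mul_of_one_le_right hLN hL) (pow_nonneg hv 3)
  nlinarith [mul_le_mul_of_nonneg_left hyoung hLN]

/-! ### Theorem 4.5 -/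

/-- **Cheskidov–Friedlander–Pavlović 2010, Theorem 4.5 — PROVED** (discharge of
`CheskidovFriedlanderPavlovic2010_thm45`): for every solution of the inviscid model (1.2)
(`λ = 2^{5/2}`, force `f₀ > 0` on the first shell; no sign condition) such that `‖a(t)‖³_{5/6}` is
integrable on `[T₁,T₂]` (`0 ≤ T₁`), the energy equality
`|a(t)|² = |a(t₀)|² + 2∫_{t₀}^t f₀a₀(τ)dτ` holds for all `T₁ ≤ t₀ ≤ t ≤ T₂`.  Proof as printed
((3.10), (4.36)–(4.39)). [cite: CheskidovFriedlanderPavlovic2010, Thm 4.5 (4.35)–(4.39) p.11] -/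
theorem CheskidovFriedlanderPavlovic2010_thm45_holds : CheskidovFriedlanderPavlovic2010_thm45 := by
  intro f₀ hf a ha T₁ T₂ hT₁ h12 hint t₀ t h0 h0t htT
  have ht₀ : 0 ≤ t₀ := hT₁.trans h0
  have hcont := ha.continuousOn
  have hsub0 : Icc t₀ t ⊆ Ici 0 := fun τ hτ => ht₀.trans hτ.1
  set L : ℝ := (2 : ℝ) ^ (5 / 2 : ℝ) with hL
  have hL1 : 1 ≤ L := Real.one_le_rpow (by norm_num) (by norm_num)
  -- the cubic weights `g_j(τ) = (λ^{2j/3}a_j(τ)²)^{3/2} = λ^j|a_j(τ)|³`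
  obtain ⟨g, hg⟩ : ∃ g : ℕ → ℝ → ℝ, g = fun (j : ℕ) (τ : ℝ) =>
      ((2 : ℝ) ^ (2 * (5 / 6) * ((j : ℕ) : ℝ)) * a j τ ^ 2) ^ (3 / 2 : ℝ) := ⟨_, rfl⟩
  have hg_eq : ∀ j τ, g j τ = L ^ j * |a j τ| ^ 3 := fun j τ => by
    rw [hg]; exact weight_rpow_three_halves j (a j τ)
  have hg0 : ∀ j τ, 0 ≤ g j τ := fun j τ => by
    rw [hg_eq]; exact mul_nonneg (pow_nonneg (by linarith) j) (pow_nonneg (abs_nonneg _) 3)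
  have hgc : ∀ j, ContinuousOn (g j) (Icc t₀ t) := fun j => by
    rw [hg]
    exact ((continuousOn_const.mul ((hcont j).pow 2)).rpow_const fun _ _ => Or.inr (by norm_num)).mono
      hsub0
  have hgi : ∀ j, IntervalIntegrable (g j) volume t₀ t := fun j => (hgc j).intervalIntegrable_of_Icc h0t
  -- (4.36): `Σ_j ofReal(g_j(τ)) ≤ ‖a(τ)‖³_{5/6}` pointwise, hence `Σ_j ∫ g_j < ∞`
  have hpt : ∀ τ, ∑' j, ENNReal.ofReal (g j τ) ≤ hsNormSq (5 / 6) (fun i => a i τ) ^ (3 / 2 : ℝ) := by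
    intro τ
    have heq : ∀ j, ENNReal.ofReal (g j τ) =
        ENNReal.ofReal ((2 : ℝ) ^ (2 * (5 / 6) * (j : ℝ)) * a j τ ^ 2) ^ (3 / 2 : ℝ) := fun j => by
      rw [hg, ENNReal.ofReal_rpow_of_nonneg (by positivity) (by norm_num)]
    simp_rw [heq]
    exact ENNReal.tsum_rpow_le_rpow_tsum _ (by norm_num)
  have hmeas : ∀ j, AEMeasurable (fun τ => ENNReal.ofReal (g j τ)) (volume.restrict (Ioc t₀ t)) :=
    fun j => (((hgc j).mono Ioc_subset_Icc_self).aemeasurable measurableSet_Ioc).ennreal_ofReal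
  have hsum_fin : ∑' j, ∫⁻ τ in Ioc t₀ t, ENNReal.ofReal (g j τ) < ⊤ := by
    rw [← lintegral_tsum hmeas]
    calc ∫⁻ τ in Ioc t₀ t, ∑' j, ENNReal.ofReal (g j τ)
        ≤ ∫⁻ τ in Ioc t₀ t, hsNormSq (5 / 6) (fun i => a i τ) ^ (3 / 2 : ℝ) := lintegral_mono fun τ => hpt τ
      _ ≤ ∫⁻ τ in Icc T₁ T₂, hsNormSq (5 / 6) (fun i => a i τ) ^ (3 / 2 : ℝ) :=
          lintegral_mono_set (Ioc_subset_Icc_self.trans (Icc_subset_Icc h0 htT))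
      _ < ⊤ := hint
  -- (4.37): `∫_{t₀}^t g_N → 0`
  have hI_eq : ∀ j, (∫ τ in t₀..t, g j τ) = (∫⁻ τ in Ioc t₀ t, ENNReal.ofReal (g j τ)).toReal := by
    intro j
    rw [intervalIntegral.integral_of_le h0t, ← ofReal_integral_eq_lintegral_ofReal
      (((hgc j).integrableOn_Icc).mono_set Ioc_subset_Icc_self) (ae_of_all _ fun τ => hg0 j τ),
      ENNReal.toReal_ofReal (integral_nonneg fun τ => hg0 j τ)]
  have hI0 : Tendsto (fun j => ∫ τ in t₀..t, g j τ) atTop (𝓝 0) := by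
    have h1 := ENNReal.tendsto_atTop_zero_of_tsum_ne_top hsum_fin.ne
    have h2 := (ENNReal.tendsto_toReal ENNReal.zero_ne_top).comp h1
    rw [ENNReal.toReal_zero] at h2
    refine h2.congr fun j => ?_
    simp only [Function.comp_apply, hI_eq]
  -- (4.38): the flux integral is squeezed by `∫g_N + ∫g_{N+1}`
  have hflux : Tendsto (fun N => ∫ τ in t₀..t, L ^ N * a N τ ^ 2 * a (N + 1) τ) atTop (𝓝 0) := by
    have hbound : ∀ N, |∫ τ in t₀..t, L ^ N * a N τ ^ 2 * a (N + 1) τ| ≤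
        (∫ τ in t₀..t, g N τ) + ∫ τ in t₀..t, g (N + 1) τ := by
      intro N
      have hFc : ContinuousOn (fun τ => L ^ N * a N τ ^ 2 * a (N + 1) τ) (Icc t₀ t) :=
        ((continuousOn_const.mul ((hcont N).pow 2)).mul (hcont (N + 1))).mono hsub0
      calc |∫ τ in t₀..t, L ^ N * a N τ ^ 2 * a (N + 1) τ|
          ≤ ∫ τ in t₀..t, |L ^ N * a N τ ^ 2 * a (N + 1) τ| :=
            intervalIntegral.abs_integral_le_integral_abs h0t
        _ ≤ ∫ τ in t₀..t, (g N τ + g (N + 1) τ) :=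
            intervalIntegral.integral_mono_on h0t (hFc.intervalIntegrable_of_Icc h0t).abs
              ((hgi N).add (hgi (N + 1))) fun τ _ => by
                rw [hg_eq, hg_eq]; exact abs_flux_le hL1 N _ _
        _ = (∫ τ in t₀..t, g N τ) + ∫ τ in t₀..t, g (N + 1) τ :=
            intervalIntegral.integral_add (hgi N) (hgi (N + 1))
    have hlim : Tendsto (fun N => (∫ τ in t₀..t, g N τ) + ∫ τ in t₀..t, g (N + 1) τ) atTop (𝓝 0) := by
      have := hI0.add (hI0.comp (tendsto_add_atTop_nat 1))
      simpa using this
    exact squeeze_zero_norm (fun N => by rw [Real.norm_eq_abs]; exact hbound N) hlim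
  -- (3.10) at `ν = 0` and the limit `N → ∞`
  have hbal : ∀ N, ∑ j ∈ range (N + 1), a j t ^ 2 - ∑ j ∈ range (N + 1), a j t₀ ^ 2 =
      -2 * (∫ τ in t₀..t, L ^ N * a N τ ^ 2 * a (N + 1) τ) + 2 * f₀ * ∫ τ in t₀..t, a 0 τ := by
    intro N
    have h := ha.truncEnergy_eq N ht₀ h0t
    rw [h, hL]
    ring
  have hEt : Tendsto (fun N => ∑ j ∈ range (N + 1), a j t ^ 2) atTop (𝓝 (normSq fun j => a j t)) :=
    ((ha.summable_sq t (ht₀.trans h0t)).hasSum.tendsto_sum_nat).comp (tendsto_add_atTop_nat 1)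
  have hEt₀ : Tendsto (fun N => ∑ j ∈ range (N + 1), a j t₀ ^ 2) atTop (𝓝 (normSq fun j => a j t₀)) :=
    ((ha.summable_sq t₀ ht₀).hasSum.tendsto_sum_nat).comp (tendsto_add_atTop_nat 1)
  have hlhs := hEt.sub hEt₀
  have hrhs : Tendsto (fun N => -2 * (∫ τ in t₀..t, L ^ N * a N τ ^ 2 * a (N + 1) τ)
      + 2 * f₀ * ∫ τ in t₀..t, a 0 τ) atTop (𝓝 (-2 * 0 + 2 * f₀ * ∫ τ in t₀..t, a 0 τ)) :=
    (hflux.const_mul (-2)).add tendsto_const_nhds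
  have heq := tendsto_nhds_unique (hlhs.congr hbal) hrhs
  rw [intervalIntegral.integral_const_mul]
  linarith

end Literature.Analysis.FluidPDE.CheskidovFriedlander2009

end
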